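import Summits.Parity.BatemanHorn.Theses.RoughValueTransport
import HarnessLib

/-!
# Route `RoughValueTransport`, crux `RoughValueLaw` (stmt-Parity-11390), line
# `increment-anchoring`: the registered stub `stub_ratioAnchoring`

`--supports` file of the checked skeleton
`Summits/Parity/BatemanHorn/Cruxes/RoughValueLaw/Lines/increment-anchoring.lean`
(crux `Summit.Parity.BatemanHorn.Theses.RoughValueTransport.RoughValueLaw`).  It PROVES the
registered TRANSFER stub `stub_ratioAnchoring` ("anchor at infinity" in multiplicative
coordinates), verbatim.  The statement is pure real analysis about an ARBITRARY real family
`Φ : ℕ → ℝ → ℝ` (no sign, monotonicity or integrality is used), an arbitrary `ω : ℝ → ℝ` of which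
only `ω(U) → e^{-γ}` (`U → ∞`) is used, a constant `B > 0` and an arbitrary threshold `u₀`:
if for every `ε > 0` the profiles `x ↦ Φ x U · (log x)^k / x` sit eventually (in `x`) inside the
band `[(1-ε), (1+ε)]·B·U^k` at every depth `U ≥ U₁(ε)`, and the RATIOS `Φ x u / Φ x U` converge to
`((uω(u))/(Uω(U)))^k` whenever `u₀ ≤ u < U`, then every rung `u ≥ u₀` converges with the FORCED
constant: `Φ x u · (log x)^k / x → B · e^{kγ} · (uω(u))^k`.

## The argument (Mathlib only; sub-namespace `RatioAnchoring` holds the arithmetic)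

Fix `u ≥ u₀`, put `c = uω(u)`, `g = e^{-γ} > 0`; the target is `L = B e^{kγ} c^k = B c^k / g^k`
(`RatioAnchoring.target_eq`).  Let `η > 0`.  Choose, in this order,
* `ε = min (1/2) (η / (3 (M + 1)))` with `M = B |c|^k (2/g)^k`, so that `ε M < η/3`;
* `U₁ = U₁(ε)` from the band hypothesis;
* ONE depth `U` with `U ≥ U₁`, `U > u`, `U > 0`, `ω(U) > g/2` and `|B c^k/ω(U)^k − L| < η/3` — all
  five hold eventually as `U → ∞` (the last one because `B c^k/ω(U)^k → B c^k/g^k = L`), so such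
  a `U` exists.
Eventually in `x` the band gives `G_x := Φ x U (log x)^k/x ∈ [(1−ε)BU^k, (1+ε)BU^k]`, so `G_x > 0`,
`Φ x U ≠ 0` and `Φ x u (log x)^k/x = r_x · G_x` EXACTLY, where `r_x = Φ x u/Φ x U → R =
(c/(Uω(U)))^k`; eventually `|r_x − R| ≤ δ := η/(6BU^k)`.  Writing
`r_x G_x − L = (r_x − R) G_x + R (G_x − BU^k) + (R BU^k − L)` (`RatioAnchoring.abs_mul_sub_lt`),
the three terms are `≤ δ · 2BU^k = η/3`, `≤ |R| ε BU^k = ε B|c|^k/ω(U)^k ≤ ε M < η/3`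
(`RatioAnchoring.abs_ratio_pow_mul_le`) and `= |B c^k/ω(U)^k − L| < η/3`
(`RatioAnchoring.ratio_pow_mul`).  Edge cases: `k = 0` (`R = 1`, `L = B`) and `u₀, u, c` of
arbitrary sign are covered by the same computation (only `U > 0`, `ω(U) > 0` are inverted).
-/

noncomputable section

open Filter Finset Polynomial
open scoped Topology BigOperators
open Literature.NumberTheory.Sieve

namespace Summit.Parity.BatemanHorn.Cruxes.RoughValueLaw.IncrementAnchoring

namespace RatioAnchoring

/-- `e^{kγ} · (e^{-γ})^k = 1`. [folklore] -/
theorem exp_mul_mul_exp_neg_pow (k : ℕ) (γ : ℝ) :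
    Real.exp ((k : ℝ) * γ) * Real.exp (-γ) ^ k = 1 := by
  rw [← Real.exp_nat_mul, ← Real.exp_add, show (k : ℝ) * γ + k * -γ = 0 by ring, Real.exp_zero]

/-- The target constant in the form used by the proof: `B e^{kγ} c^k = B c^k / (e^{-γ})^k`.
[folklore] -/
theorem target_eq (k : ℕ) (B c γ : ℝ) :
    B * Real.exp ((k : ℝ) * γ) * c ^ k = B * c ^ k / Real.exp (-γ) ^ k := by
  rw [eq_div_iff (pow_ne_zero _ (Real.exp_pos _).ne'),
    show B * Real.exp ((k : ℝ) * γ) * c ^ k * Real.exp (-γ) ^ k =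
      B * c ^ k * (Real.exp ((k : ℝ) * γ) * Real.exp (-γ) ^ k) by ring,
    exp_mul_mul_exp_neg_pow, mul_one]

/-- `R · BU^k = B c^k / w^k` for the ratio limit `R = (c/(Uw))^k` (`U, w ≠ 0`). [folklore] -/
theorem ratio_pow_mul (k : ℕ) {c U w : ℝ} (B : ℝ) (hU : U ≠ 0) (hw : w ≠ 0) :
    (c / (U * w)) ^ k * (B * U ^ k) = B * c ^ k / w ^ k := by
  have hUk : U ^ k ≠ 0 := pow_ne_zero _ hU
  have hwk : w ^ k ≠ 0 := pow_ne_zero _ hw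
  rw [div_pow, mul_pow, div_mul_eq_mul_div, div_eq_div_iff (mul_ne_zero hUk hwk) hwk]
  ring

/-- The middle error term: for `U > 0`, `w > g/2 > 0`, `ε, B ≥ 0`,
`|(c/(Uw))^k| · ε B U^k = ε B |c|^k / w^k ≤ ε · (B |c|^k (2/g)^k)`. [folklore] -/
theorem abs_ratio_pow_mul_le (k : ℕ) (c : ℝ) {U w g ε B : ℝ} (hU : 0 < U) (hg : 0 < g)
    (hw : g / 2 < w) (hε : 0 ≤ ε) (hB : 0 ≤ B) :
    |(c / (U * w)) ^ k| * (ε * (B * U ^ k)) ≤ ε * (B * |c| ^ k * (2 / g) ^ k) := by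
  have hw0 : 0 < w := (half_pos hg).trans hw
  have hUk : U ^ k ≠ 0 := pow_ne_zero _ hU.ne'
  have h1 : |(c / (U * w)) ^ k| * (ε * (B * U ^ k)) = ε * (B * |c| ^ k * (w ^ k)⁻¹) := by
    rw [abs_pow, abs_div, abs_mul, abs_of_pos hU, abs_of_pos hw0, div_pow, mul_pow,
      div_eq_mul_inv, mul_inv]
    calc |c| ^ k * ((U ^ k)⁻¹ * (w ^ k)⁻¹) * (ε * (B * U ^ k))
        = ε * (B * |c| ^ k * (w ^ k)⁻¹) * (U ^ k * (U ^ k)⁻¹) := by ring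
      _ = ε * (B * |c| ^ k * (w ^ k)⁻¹) := by rw [mul_inv_cancel₀ hUk, mul_one]
  have h2 : (w ^ k)⁻¹ ≤ (2 / g) ^ k := by
    rw [← inv_pow]
    refine pow_le_pow_left₀ (inv_nonneg.2 hw0.le) ?_ k
    rw [inv_le_comm₀ hw0 (by positivity), inv_div]
    exact hw.le
  rw [h1]
  exact mul_le_mul_of_nonneg_left (mul_le_mul_of_nonneg_left h2 (by positivity)) hε

/-- The pointwise three-term estimate.  If `|r − R| ≤ δ` (`δ ≥ 0`), `G ∈ [(1−ε)D, (1+ε)D]` with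
`D > 0`, `ε ≤ 1`, and the three error budgets `δ·2D ≤ η/3`, `|R|·εD < η/3`, `|RD − L| < η/3`
hold, then `|rG − L| < η`, via `rG − L = (r − R)G + R(G − D) + (RD − L)`. [folklore] -/
theorem abs_mul_sub_lt {r R G D L η δ ε : ℝ} (hD : 0 < D) (hε1 : ε ≤ 1) (hδ : 0 ≤ δ)
    (hr : |r - R| ≤ δ) (hG1 : (1 - ε) * D ≤ G) (hG2 : G ≤ (1 + ε) * D)
    (h1 : δ * (2 * D) ≤ η / 3) (h2 : |R| * (ε * D) < η / 3) (h3 : |R * D - L| < η / 3) :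
    |r * G - L| < η := by
  have hεD : ε * D ≤ 1 * D := mul_le_mul_of_nonneg_right hε1 hD.le
  have hG0 : 0 ≤ G := le_trans (mul_nonneg (by linarith) hD.le) hG1
  have hGle : G ≤ 2 * D := by linarith
  have hGD : |G - D| ≤ ε * D := abs_le.2 ⟨by linarith, by linarith⟩
  have hdec : r * G - L = (r - R) * G + R * (G - D) + (R * D - L) := by ring
  have t1 : |(r - R) * G| ≤ η / 3 := by
    rw [abs_mul, abs_of_nonneg hG0]
    exact (mul_le_mul hr hGle hG0 hδ).trans h1
  have t2 : |R * (G - D)| < η / 3 := by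
    rw [abs_mul]
    exact (mul_le_mul_of_nonneg_left hGD (abs_nonneg _)).trans_lt h2
  rw [hdec]
  calc |(r - R) * G + R * (G - D) + (R * D - L)|
      ≤ |(r - R) * G| + |R * (G - D)| + |R * D - L| := abs_add_three _ _ _
    _ < η / 3 + η / 3 + η / 3 := by linarith
    _ = η := by ring

end RatioAnchoring

/-- **stub_ratioAnchoring** (registered stub S3 of the skeleton
`Cruxes/RoughValueLaw/Lines/increment-anchoring.lean`, crux stmt-Parity-11390) — the TRANSFER
stub "anchor at infinity" in multiplicative coordinates.  If the profiles
`x ↦ Φ x U·(log x)^k/x` sit, for every `ε > 0`, eventually inside `[(1−ε), (1+ε)]·B·U^k` at every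
depth `U ≥ U₁(ε)`, if `ω(U) → e^{−γ}`, and if the ratios `Φ x u / Φ x U → ((uω(u))/(Uω(U)))^k`
for `u₀ ≤ u < U`, then every rung `u ≥ u₀` converges and the constant is forced:
`Φ x u·(log x)^k/x → B·e^{kγ}·(uω(u))^k`.  Proof: module docstring (an `η/3` argument; the
depth `U` is chosen after `ε`, from five eventually-true properties of `U → ∞`). [folklore] -/
theorem stub_ratioAnchoring :
    ∀ (k : ℕ) (Φ : ℕ → ℝ → ℝ) (ω : ℝ → ℝ) (B u₀ : ℝ), 0 < B →
      Tendsto ω atTop (𝓝 (Real.exp (-Real.eulerMascheroniConstant))) →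
      (∀ ε : ℝ, 0 < ε → ∃ U₁ : ℝ, ∀ U : ℝ, U₁ ≤ U → ∀ᶠ x : ℕ in atTop,
        (1 - ε) * (B * U ^ k) ≤ Φ x U * Real.log x ^ k / (x : ℝ) ∧
          Φ x U * Real.log x ^ k / (x : ℝ) ≤ (1 + ε) * (B * U ^ k)) →
      (∀ u U : ℝ, u₀ ≤ u → u < U →
        Tendsto (fun x : ℕ => Φ x u / Φ x U) atTop (𝓝 ((u * ω u / (U * ω U)) ^ k))) →
      ∀ u : ℝ, u₀ ≤ u →
        Tendsto (fun x : ℕ => Φ x u * Real.log x ^ k / (x : ℝ)) atTop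
          (𝓝 (B * Real.exp ((k : ℝ) * Real.eulerMascheroniConstant) * (u * ω u) ^ k)) := by
  intro k Φ ω B u₀ hB hω hband hratio u hu
  -- `g = e^{-γ} > 0`, `c = uω(u)`; the target is `B c^k / g^k`
  obtain ⟨g, hg⟩ : ∃ g : ℝ, g = Real.exp (-Real.eulerMascheroniConstant) := ⟨_, rfl⟩
  obtain ⟨c, hc⟩ : ∃ c : ℝ, c = u * ω u := ⟨_, rfl⟩
  have hg0 : 0 < g := by rw [hg]; exact Real.exp_pos _
  rw [RatioAnchoring.target_eq, ← hg, ← hc, Metric.tendsto_nhds]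
  rw [← hg] at hω
  intro η hη
  -- Step 1: the width `ε`
  have hM0 : 0 ≤ B * |c| ^ k * (2 / g) ^ k := by positivity
  obtain ⟨ε, hε0, hε1, hεM⟩ : ∃ ε : ℝ, 0 < ε ∧ ε ≤ 1 / 2 ∧
      ε * (B * |c| ^ k * (2 / g) ^ k) < η / 3 := by
    refine ⟨min (1 / 2) (η / (3 * (B * |c| ^ k * (2 / g) ^ k + 1))), lt_min (by norm_num)
      (by positivity), min_le_left _ _, ?_⟩
    refine (mul_le_mul_of_nonneg_right (min_le_right _ _) hM0).trans_lt ?_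
    rw [div_mul_eq_mul_div, div_lt_div_iff₀ (by positivity) (by positivity)]
    nlinarith
  -- Step 2: the depth threshold `U₁(ε)`
  obtain ⟨U₁, hU₁⟩ := hband ε hε0
  -- Step 3: ONE depth `U`, from five eventually-true properties of `U → ∞`
  have hlim : Tendsto (fun U : ℝ => B * c ^ k * (ω U ^ k)⁻¹) atTop
      (𝓝 (B * c ^ k * (g ^ k)⁻¹)) :=
    ((hω.pow k).inv₀ (pow_ne_zero k hg0.ne')).const_mul (B * c ^ k)
  obtain ⟨U, hUU₁, huU, hU0, hωU, hdU⟩ : ∃ U : ℝ, U₁ ≤ U ∧ u < U ∧ 0 < U ∧ g / 2 < ω U ∧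
      dist (B * c ^ k * (ω U ^ k)⁻¹) (B * c ^ k * (g ^ k)⁻¹) < η / 3 :=
    ((eventually_ge_atTop U₁).and <| (eventually_gt_atTop u).and <|
      (eventually_gt_atTop (0 : ℝ)).and <| (hω.eventually_const_lt (half_lt_self hg0)).and <|
        Metric.tendsto_nhds.1 hlim (η / 3) (by positivity)).exists
  have hωU0 : 0 < ω U := (half_pos hg0).trans hωU
  have hD0 : 0 < B * U ^ k := by positivity
  -- the two `x`-independent error budgets at depth `U`
  have h2 : |(c / (U * ω U)) ^ k| * (ε * (B * U ^ k)) < η / 3 :=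
    (RatioAnchoring.abs_ratio_pow_mul_le k c hU0 hg0 hωU hε0.le hB.le).trans_lt hεM
  have h3 : |(c / (U * ω U)) ^ k * (B * U ^ k) - B * c ^ k / g ^ k| < η / 3 := by
    rw [RatioAnchoring.ratio_pow_mul k B hU0.ne' hωU0.ne', div_eq_mul_inv, div_eq_mul_inv,
      ← Real.dist_eq]
    exact hdU
  -- Step 4: eventually in `x`
  have hδ0 : 0 < η / (6 * (B * U ^ k)) := by positivity
  have hδD : η / (6 * (B * U ^ k)) * (2 * (B * U ^ k)) ≤ η / 3 := by
    rw [div_mul_eq_mul_div, div_le_iff₀ (by positivity)]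
    exact le_of_eq (by ring)
  have hr := Metric.tendsto_nhds.1 (hratio u U hu huU) _ hδ0
  rw [← hc] at hr
  filter_upwards [hU₁ U hUU₁, hr] with x hx hrx
  rw [Real.dist_eq] at hrx ⊢
  -- `Φ x U ≠ 0` and the EXACT factorisation `Φ x u ℓ_x = (Φ x u / Φ x U) · (Φ x U ℓ_x)`
  have hGpos : 0 < Φ x U * Real.log x ^ k / (x : ℝ) :=
    lt_of_lt_of_le (mul_pos (by linarith) hD0) hx.1
  have hΦU : Φ x U ≠ 0 := by
    intro h
    rw [h, zero_mul, zero_div] at hGpos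
    exact lt_irrefl _ hGpos
  have hfac : Φ x u * Real.log x ^ k / (x : ℝ) =
      Φ x u / Φ x U * (Φ x U * Real.log x ^ k / (x : ℝ)) := by
    rw [← mul_div_assoc, ← mul_assoc, div_mul_cancel₀ _ hΦU]
  rw [hfac]
  exact RatioAnchoring.abs_mul_sub_lt hD0 (by linarith) hδ0.le hrx.le hx.1 hx.2 hδD h2 h3

end Summit.Parity.BatemanHorn.Cruxes.RoughValueLaw.IncrementAnchoring
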